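import Literature.Probability.Percolation.ArmSeparationUntwistFour
import HarnessLib

/-!
# Untwisting the half-turned landing: locality and probabilities of the U-turn corridors

Topic `Literature/Probability/Percolation`; family `crit-perc` / near-critical percolation on `𝕋`
(P. Nolin, *Near-critical percolation in two dimensions*, EJP 13 (2008), §4.2–4.4, arXiv 0711.4948).
For the U-turn corridors `uTurnA r`, `uTurnB r` of `ArmSeparationUntwistFour`: the sites they depend
on (`uTurnAFinset`, `uTurnBFinset`, `determinedBy_uTurnA`, `determinedBy_uTurnB`), the boxes
containing those sites (`uTurnAFinset_subset`, `uTurnBFinset_subset`), and RSW-and-Harris lower bounds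
at `q` (`le_real_uTurnA_at`, `le_real_uTurnB_at`: `c^101` each). Everything here is proved; no named
facts are introduced.

## References

* P. Nolin, Near-critical percolation in two dimensions, *Electron. J. Probab.* 13 (2008), §4.2–4.4
  (arXiv 0711.4948: Def. 6–8, Prop. 11, Lemma 12) [Nolin2008].
-/

noncomputable section

open MeasureTheory Set

namespace Literature.Probability.Percolation

open LatticeModels

/-! ### Locality of the open U-turn -/

/-- The sites of the boxes of the open U-turn. [folklore] -/
def uBoxAF (r : ℕ) : ℕ → Finset (Site 2)
  | 0 => triStripFinset ((r : ℤ) - (r / 8 : ℕ) - (r / 16 : ℕ) - 2) (-(sepGlueHeight r : ℤ)) (r / 16) (sepGlueHeight r + 4 * (r / 64))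
  | 1 => triStripFinset (30 * (r / 64 : ℕ)) (2 * (r / 64 : ℕ)) (r - r / 8 - 2 - 30 * (r / 64)) (2 * (r / 64))
  | 2 => triStripFinset (30 * (r / 64 : ℕ)) (2 * (r / 64 : ℕ)) (2 * (r / 64)) (12 * (r / 64))
  | 3 => triStripFinset (10 * (r / 64 : ℕ)) (12 * (r / 64 : ℕ)) (22 * (r / 64)) (2 * (r / 64))
  | 4 => triStripFinset (10 * (r / 64 : ℕ)) (12 * (r / 64 : ℕ)) (2 * (r / 64)) (14 * (r / 64))
  | 5 => triStripFinset (-(6 * (r / 64 : ℕ) : ℤ)) (24 * (r / 64 : ℕ)) (18 * (r / 64)) (2 * (r / 64))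
  | 6 => triStripFinset (-(6 * (r / 64 : ℕ) : ℤ)) (13 * (r / 64 : ℕ)) (2 * (r / 64)) (13 * (r / 64))
  | 7 => triStripFinset (-(13 * (r / 64 : ℕ) : ℤ)) (13 * (r / 64 : ℕ)) (9 * (r / 64)) (2 * (r / 64))
  | 8 => triStripFinset (-(13 * (r / 64 : ℕ) : ℤ)) (3 * (r / 64 : ℕ)) (2 * (r / 64)) (12 * (r / 64))
  | 9 => triStripFinset (-(13 * (r / 64 : ℕ) : ℤ)) (4 * (r / 64 : ℕ) - (8 * (r / 64) / 64 : ℕ)) (6 * (r / 64) - 1) (8 * (r / 64) / 64)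
  | _ => ∅

/-- The sites of the `i`-th comb strip of the open U-turn. [folklore] -/
def uCombAF (r i : ℕ) : Finset (Site 2) :=
  triStripFinset ((r : ℤ) - (r / 8 : ℕ) - (r / 16 : ℕ) - 2) (-(sepGlueHeight r : ℤ) + i * ((r / 64 / 2 : ℕ) : ℤ)) (r / 8 + r / 16 + 1) (r / 64 / 2)

/-- The sites of the new free space of the open U-turn (the half turn of the standard strip). [folklore] -/
def uFenceAF (r : ℕ) : Finset (Site 2) :=
  (triStripFinset ((8 * (r / 64) : ℕ) - (8 * (r / 64) / 8 : ℕ) + 1) (-((8 * (r / 64) / 2 : ℕ) : ℤ) - (8 * (r / 64) / 64 : ℕ))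
    (8 * (r / 64) / 8 - 2) (2 * (8 * (r / 64) / 64))).image (triRotIsoPow 3)

/-- Locality of the boxes of the open U-turn. [folklore] -/
theorem determinedBy_uBoxA (r : ℕ) {k : ℕ} (hk : k < 10) : DeterminedBy (uBoxA r k) ↑(uBoxAF r k) := by
  interval_cases k
  · rw [uBoxA, uBoxAF]; exact determinedBy_triVCross _ _ _ _
  · rw [uBoxA, uBoxAF]; exact determinedBy_triHCross _ _ _ _
  · rw [uBoxA, uBoxAF]; exact determinedBy_triVCross _ _ _ _
  · rw [uBoxA, uBoxAF]; exact determinedBy_triHCross _ _ _ _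
  · rw [uBoxA, uBoxAF]; exact determinedBy_triVCross _ _ _ _
  · rw [uBoxA, uBoxAF]; exact determinedBy_triHCross _ _ _ _
  · rw [uBoxA, uBoxAF]; exact determinedBy_triVCross _ _ _ _
  · rw [uBoxA, uBoxAF]; exact determinedBy_triHCross _ _ _ _
  · rw [uBoxA, uBoxAF]; exact determinedBy_triVCross _ _ _ _
  · rw [uBoxA, uBoxAF]; exact determinedBy_triHCross _ _ _ _

/-- The boxes of the open U-turn are increasing events. [folklore] -/
theorem isUpperSet_uBoxA (r : ℕ) {k : ℕ} (hk : k < 10) : IsUpperSet (uBoxA r k) := by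
  interval_cases k
  · rw [uBoxA]; exact isUpperSet_triVCross _ _ _ _
  · rw [uBoxA]; exact isUpperSet_triHCross _ _ _ _
  · rw [uBoxA]; exact isUpperSet_triVCross _ _ _ _
  · rw [uBoxA]; exact isUpperSet_triHCross _ _ _ _
  · rw [uBoxA]; exact isUpperSet_triVCross _ _ _ _
  · rw [uBoxA]; exact isUpperSet_triHCross _ _ _ _
  · rw [uBoxA]; exact isUpperSet_triVCross _ _ _ _
  · rw [uBoxA]; exact isUpperSet_triHCross _ _ _ _
  · rw [uBoxA]; exact isUpperSet_triVCross _ _ _ _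
  · rw [uBoxA]; exact isUpperSet_triHCross _ _ _ _

/-- Locality of the new free space of the open U-turn. [folklore] -/
theorem determinedBy_uFenceA (r : ℕ) : DeterminedBy (uFenceA r) ↑(uFenceAF r) := by
  rw [uFenceA, uFenceAF, Finset.coe_image]
  exact determinedBy_preimage_rotConfig 3 (determinedBy_triVCross _ _ _ _)

/-- Reading through the half turn preserves monotonicity of a vertical crossing event. [folklore] -/
theorem isUpperSet_rot3_triVCross (a b : ℤ) (w h : ℕ) :
    IsUpperSet {χ : SiteConfig (Site 2) | rotConfig 3 χ ∈ triVCross a b w h} := fun _ _ hle hω =>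
  isUpperSet_triVCross a b w h (fun v hv => by rw [mem_rotConfig] at hv ⊢; exact hle hv) hω

/-- `uTurnA` is increasing. [folklore] -/
theorem isUpperSet_uTurnA (r : ℕ) : IsUpperSet (uTurnA r) := by
  have h1 : IsUpperSet (uFenceA r) :=
    isUpperSet_rot3_triVCross ((8 * (r / 64) : ℕ) - (8 * (r / 64) / 8 : ℕ) + 1) (-((8 * (r / 64) / 2 : ℕ) : ℤ) - (8 * (r / 64) / 64 : ℕ))
      (8 * (r / 64) / 8 - 2) (2 * (8 * (r / 64) / 64))
  have h2 : IsUpperSet (⋂ k ∈ Finset.range 10, uBoxA r k) := isUpperSet_iInter₂ fun k hk => isUpperSet_uBoxA r (Finset.mem_range.1 hk)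
  have h3 : IsUpperSet (⋂ i ∈ Finset.range 90, uCombA r i) := isUpperSet_iInter₂ fun i _ =>
    isUpperSet_triHCross ((r : ℤ) - (r / 8 : ℕ) - (r / 16 : ℕ) - 2) (-(sepGlueHeight r : ℤ) + i * ((r / 64 / 2 : ℕ) : ℤ)) (r / 8 + r / 16 + 1) (r / 64 / 2)
  exact (h1.inter h2).inter h3

/-- The sites of the open U-turn. [folklore] -/
def uTurnAFinset (r : ℕ) : Finset (Site 2) :=
  uFenceAF r ∪ (Finset.range 10).biUnion (uBoxAF r) ∪ (Finset.range 90).biUnion (uCombAF r)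

/-- **Locality of the open U-turn.** [folklore] -/
theorem determinedBy_uTurnA (r : ℕ) : DeterminedBy (uTurnA r) ↑(uTurnAFinset r) := by
  classical
  rw [uTurnA, uTurnAFinset, Finset.coe_union, Finset.coe_union]
  refine (DeterminedBy.inter ((determinedBy_uFenceA r).mono (Set.subset_union_left.trans Set.subset_union_left))
    (DeterminedBy.mono ?_ (Set.subset_union_right.trans Set.subset_union_left))).inter (DeterminedBy.mono ?_ Set.subset_union_right)
  · exact DeterminedBy.biInter_finset (Finset.range 10) (E := fun k => uBoxA r k) (F := fun k => uBoxAF r k)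
      fun k hk => determinedBy_uBoxA r (Finset.mem_range.1 hk)
  · exact DeterminedBy.biInter_finset (Finset.range 90) (E := fun i => uCombA r i) (F := fun i => uCombAF r i)
      fun i _ => determinedBy_triHCross _ _ _ _

/-! ### Locality of the closed U-turn -/

/-- The sites of the boxes of the closed U-turn. [folklore] -/
def uBoxBF (r : ℕ) : ℕ → Finset (Site 2)
  | 0 => triStripFinset (-(55 * (r / 64 : ℕ) : ℤ)) ((r : ℤ) - (r / 8 : ℕ) - (r / 16 : ℕ) - 2) (55 * (r / 64)) (r / 16)
  | 1 => triStripFinset (-(50 * (r / 64 : ℕ) : ℤ)) (30 * (r / 64 : ℕ)) (2 * (r / 64)) (r - r / 8 - 2 - 30 * (r / 64))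
  | 2 => triStripFinset (-(50 * (r / 64 : ℕ) : ℤ)) (30 * (r / 64 : ℕ)) (16 * (r / 64)) (2 * (r / 64))
  | 3 => triStripFinset (-(36 * (r / 64 : ℕ) : ℤ)) (10 * (r / 64 : ℕ)) (2 * (r / 64)) (22 * (r / 64))
  | 4 => triStripFinset (-(36 * (r / 64 : ℕ) : ℤ)) (10 * (r / 64 : ℕ)) (16 * (r / 64)) (2 * (r / 64))
  | 5 => triStripFinset (-(22 * (r / 64 : ℕ) : ℤ)) (-(4 * (r / 64 : ℕ) : ℤ)) (2 * (r / 64)) (16 * (r / 64))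
  | 6 => triStripFinset (-(22 * (r / 64 : ℕ) : ℤ)) (-(4 * (r / 64 : ℕ) : ℤ)) (15 * (r / 64)) (2 * (r / 64))
  | 7 => triStripFinset (-(9 * (r / 64 : ℕ) : ℤ)) (-(11 * (r / 64 : ℕ) : ℤ)) (2 * (r / 64)) (9 * (r / 64))
  | 8 => triStripFinset (-(9 * (r / 64 : ℕ) : ℤ)) (-(11 * (r / 64 : ℕ) : ℤ)) (13 * (r / 64)) (2 * (r / 64))
  | 9 => triStripFinset (4 * (r / 64 : ℕ) - (8 * (r / 64) / 64 : ℕ)) (-(11 * (r / 64 : ℕ) : ℤ)) (8 * (r / 64) / 64) (4 * (r / 64) - 1)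
  | _ => ∅

/-- The sites of the new free space of the closed U-turn (the reflection of the standard strip). [folklore] -/
def uFenceBF (r : ℕ) : Finset (Site 2) :=
  (triStripFinset ((8 * (r / 64) : ℕ) - (8 * (r / 64) / 8 : ℕ) + 1) (-((8 * (r / 64) / 2 : ℕ) : ℤ) - (8 * (r / 64) / 64 : ℕ))
    (8 * (r / 64) / 8 - 2) (2 * (8 * (r / 64) / 64))).image (frameIso 5)

/-- Locality of the boxes of the closed U-turn. [folklore] -/
theorem determinedBy_uBoxB (r : ℕ) {k : ℕ} (hk : k < 10) : DeterminedBy (uBoxB r k) ↑(uBoxBF r k) := by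
  interval_cases k
  · rw [uBoxB, uBoxBF]; exact determinedBy_triHCross _ _ _ _
  · rw [uBoxB, uBoxBF]; exact determinedBy_triVCross _ _ _ _
  · rw [uBoxB, uBoxBF]; exact determinedBy_triHCross _ _ _ _
  · rw [uBoxB, uBoxBF]; exact determinedBy_triVCross _ _ _ _
  · rw [uBoxB, uBoxBF]; exact determinedBy_triHCross _ _ _ _
  · rw [uBoxB, uBoxBF]; exact determinedBy_triVCross _ _ _ _
  · rw [uBoxB, uBoxBF]; exact determinedBy_triHCross _ _ _ _
  · rw [uBoxB, uBoxBF]; exact determinedBy_triVCross _ _ _ _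
  · rw [uBoxB, uBoxBF]; exact determinedBy_triHCross _ _ _ _
  · rw [uBoxB, uBoxBF]; exact determinedBy_triVCross _ _ _ _

/-- The boxes of the closed U-turn are increasing events. [folklore] -/
theorem isUpperSet_uBoxB (r : ℕ) {k : ℕ} (hk : k < 10) : IsUpperSet (uBoxB r k) := by
  interval_cases k
  · rw [uBoxB]; exact isUpperSet_triHCross _ _ _ _
  · rw [uBoxB]; exact isUpperSet_triVCross _ _ _ _
  · rw [uBoxB]; exact isUpperSet_triHCross _ _ _ _
  · rw [uBoxB]; exact isUpperSet_triVCross _ _ _ _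
  · rw [uBoxB]; exact isUpperSet_triHCross _ _ _ _
  · rw [uBoxB]; exact isUpperSet_triVCross _ _ _ _
  · rw [uBoxB]; exact isUpperSet_triHCross _ _ _ _
  · rw [uBoxB]; exact isUpperSet_triVCross _ _ _ _
  · rw [uBoxB]; exact isUpperSet_triHCross _ _ _ _
  · rw [uBoxB]; exact isUpperSet_triVCross _ _ _ _

/-- Locality of the new free space of the closed U-turn. [folklore] -/
theorem determinedBy_uFenceB (r : ℕ) : DeterminedBy (uFenceB r) ↑(uFenceBF r) := by
  rw [uFenceB, uFenceBF, Finset.coe_image]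
  exact determinedBy_preimage_frameConfig 5 (determinedBy_triVCross _ _ _ _)

/-- `uTurnB` is increasing. [folklore] -/
theorem isUpperSet_uTurnB (r : ℕ) : IsUpperSet (uTurnB r) := by
  have h1 : IsUpperSet (uFenceB r) := isUpperSet_preimage_frameConfig 5
    (isUpperSet_triVCross ((8 * (r / 64) : ℕ) - (8 * (r / 64) / 8 : ℕ) + 1) (-((8 * (r / 64) / 2 : ℕ) : ℤ) - (8 * (r / 64) / 64 : ℕ))
      (8 * (r / 64) / 8 - 2) (2 * (8 * (r / 64) / 64)))
  have h2 : IsUpperSet (⋂ k ∈ Finset.range 10, uBoxB r k) := isUpperSet_iInter₂ fun k hk => isUpperSet_uBoxB r (Finset.mem_range.1 hk)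
  have h3 : IsUpperSet (⋂ i ∈ Finset.range 90, inCombB r i) := isUpperSet_iInter₂ fun i _ =>
    isUpperSet_triVCross (-(sepGlueHeight r : ℤ) + i * ((r / 64 / 2 : ℕ) : ℤ)) ((r : ℤ) - (r / 8 : ℕ) - (r / 16 : ℕ) - 2) (r / 64 / 2) (r / 8 + r / 16 + 1)
  exact (h1.inter h2).inter h3

/-- The sites of the closed U-turn. [folklore] -/
def uTurnBFinset (r : ℕ) : Finset (Site 2) :=
  uFenceBF r ∪ (Finset.range 10).biUnion (uBoxBF r) ∪ (Finset.range 90).biUnion (inCombBF r)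

/-- **Locality of the closed U-turn.** [folklore] -/
theorem determinedBy_uTurnB (r : ℕ) : DeterminedBy (uTurnB r) ↑(uTurnBFinset r) := by
  classical
  rw [uTurnB, uTurnBFinset, Finset.coe_union, Finset.coe_union]
  refine (DeterminedBy.inter ((determinedBy_uFenceB r).mono (Set.subset_union_left.trans Set.subset_union_left))
    (DeterminedBy.mono ?_ (Set.subset_union_right.trans Set.subset_union_left))).inter (DeterminedBy.mono ?_ Set.subset_union_right)
  · exact DeterminedBy.biInter_finset (Finset.range 10) (E := fun k => uBoxB r k) (F := fun k => uBoxBF r k)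
      fun k hk => determinedBy_uBoxB r (Finset.mem_range.1 hk)
  · exact DeterminedBy.biInter_finset (Finset.range 90) (E := fun i => inCombB r i) (F := fun i => inCombBF r i)
      fun i _ => determinedBy_triVCross _ _ _ _

/-! ### Probabilities -/

/-- Arithmetic helper. [folklore] -/
private theorem masterUP {r : ℕ} (hr : 4096 ≤ r) :
    1 ≤ 8 * (r / 64) / 64 ∧ 8 * (8 * (r / 64) / 64) ≤ r / 64 ∧ 64 * (8 * (r / 64) / 64) + 56 ≥ 8 * (r / 64) ∧
    8 * (r / 64) / 8 = r / 64 ∧ 64 ≤ r / 64 ∧ 8 * (r / 64) ≤ r ∧ r / 8 + r / 16 + 1 ≤ 64 * (r / 64 / 2) ∧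
    sepGlueHeight r + 4 * (r / 64) ≤ 64 * (r / 16) ∧ 1 ≤ r / 16 ∧ r / 16 ≤ r ∧
    r - r / 8 - 2 - 30 * (r / 64) ≤ 128 * (r / 64) ∧ 55 * (r / 64) ≤ 64 * (r / 16) ∧ 1 ≤ r / 64 / 2 := by
  have hGH : sepGlueHeight r = r - r / 4 + r / 64 := rfl
  refine ⟨by omega, by omega, by omega, by omega, by omega, by omega, by omega, by rw [hGH]; omega, by omega, by omega,
    by omega, by omega, by omega⟩

/-- **RSW and Harris for the open U-turn at `q`**: with the RSW input at `q` (aspect ratio `ρ ≥ 64`,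
heights `≤ Ncap`), `P_q(uTurnA r) ≥ c^101` (`4096 ≤ r ≤ Ncap`). [cite: Nolin2008, §4.3 Prop. 12 (proof) (arXiv 0711.4948: Prop. 11)] -/
theorem le_real_uTurnA_at (q : unitInterval) {c : ℝ} {ρ Ncap : ℕ}
    (hrsw : ∀ k : ℕ, 1 ≤ ⌊(ρ : ℝ) * k⌋₊ → k ≤ Ncap → c ≤ triLRCrossingProb q ⌊(ρ : ℝ) * k⌋₊ k)
    (hρ : 64 ≤ ρ) (hc : 0 ≤ c) {r : ℕ} (hr : 4096 ≤ r) (hcap : r ≤ Ncap) :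
    c ^ 101 ≤ (triSitePercolation q).real (uTurnA r) := by
  classical
  have hfl : ∀ k : ℕ, ⌊(ρ : ℝ) * (k : ℕ)⌋₊ = ρ * k := fun k => by
    have : (ρ : ℝ) * (k : ℕ) = ((ρ * k : ℕ) : ℝ) := by push_cast; ring
    rw [this, Nat.floor_natCast]
  have hcw : ∀ L k : ℕ, 1 ≤ k → k ≤ Ncap → L ≤ 64 * k → c ≤ triLRCrossingProb q L k := fun L k hk hkc hL => by
    have h := hrsw k (by rw [hfl]; nlinarith) hkc
    rw [hfl] at h
    exact h.trans (triLRCrossingProb_anti_width q (by nlinarith) k)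
  obtain ⟨u1, u2, u3, u4, u5, u6, u7, u8, u9, u10, u11, u12, u13⟩ := masterUP hr
  -- the fence
  have hF : c ≤ (sitePercolation (Site 2) q).real (uFenceA r) := by
    have h1 := real_preimage_rotConfig q 3
      (triVCross ((8 * (r / 64) : ℕ) - (8 * (r / 64) / 8 : ℕ) + 1) (-((8 * (r / 64) / 2 : ℕ) : ℤ) - (8 * (r / 64) / 64 : ℕ))
        (8 * (r / 64) / 8 - 2) (2 * (8 * (r / 64) / 64)))
    rw [triSitePercolation_real_triVCross] at h1
    unfold triSitePercolation at h1
    rw [uFenceA, show {χ : SiteConfig (Site 2) | rotConfig 3 χ ∈ triVCross ((8 * (r / 64) : ℕ) - (8 * (r / 64) / 8 : ℕ) + 1)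
        (-((8 * (r / 64) / 2 : ℕ) : ℤ) - (8 * (r / 64) / 64 : ℕ)) (8 * (r / 64) / 8 - 2) (2 * (8 * (r / 64) / 64))} =
      rotConfig 3 ⁻¹' triVCross ((8 * (r / 64) : ℕ) - (8 * (r / 64) / 8 : ℕ) + 1) (-((8 * (r / 64) / 2 : ℕ) : ℤ) - (8 * (r / 64) / 64 : ℕ))
        (8 * (r / 64) / 8 - 2) (2 * (8 * (r / 64) / 64)) from rfl, h1]
    exact hcw _ _ (by omega) (by omega) (by omega)
  -- the boxes
  have hs : ∀ k ∈ Finset.range 10, c ≤ (sitePercolation (Site 2) q).real (uBoxA r k) := by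
    intro k hk
    have hk' := Finset.mem_range.1 hk
    interval_cases k
    · rw [uBoxA, show sitePercolation (Site 2) q = triSitePercolation q from rfl, triSitePercolation_real_triVCross]
      exact hcw _ _ (by omega) (by omega) (by omega)
    · rw [uBoxA, show sitePercolation (Site 2) q = triSitePercolation q from rfl, triSitePercolation_real_triHCross]
      exact hcw _ _ (by omega) (by omega) (by omega)
    · rw [uBoxA, show sitePercolation (Site 2) q = triSitePercolation q from rfl, triSitePercolation_real_triVCross]
      exact hcw _ _ (by omega) (by omega) (by omega)
    · rw [uBoxA, show sitePercolation (Site 2) q = triSitePercolation q from rfl, triSitePercolation_real_triHCross]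
      exact hcw _ _ (by omega) (by omega) (by omega)
    · rw [uBoxA, show sitePercolation (Site 2) q = triSitePercolation q from rfl, triSitePercolation_real_triVCross]
      exact hcw _ _ (by omega) (by omega) (by omega)
    · rw [uBoxA, show sitePercolation (Site 2) q = triSitePercolation q from rfl, triSitePercolation_real_triHCross]
      exact hcw _ _ (by omega) (by omega) (by omega)
    · rw [uBoxA, show sitePercolation (Site 2) q = triSitePercolation q from rfl, triSitePercolation_real_triVCross]
      exact hcw _ _ (by omega) (by omega) (by omega)
    · rw [uBoxA, show sitePercolation (Site 2) q = triSitePercolation q from rfl, triSitePercolation_real_triHCross]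
      exact hcw _ _ (by omega) (by omega) (by omega)
    · rw [uBoxA, show sitePercolation (Site 2) q = triSitePercolation q from rfl, triSitePercolation_real_triVCross]
      exact hcw _ _ (by omega) (by omega) (by omega)
    · rw [uBoxA, show sitePercolation (Site 2) q = triSitePercolation q from rfl, triSitePercolation_real_triHCross]
      exact hcw _ _ (by omega) (by omega) (by omega)
  have hS := sitePercolation_real_biInter_ge_prod q (Finset.range 10) (E := fun k => uBoxA r k)
    (F := fun k => uBoxAF r k) (fun k hk => determinedBy_uBoxA r (Finset.mem_range.1 hk))
    (fun k hk => isUpperSet_uBoxA r (Finset.mem_range.1 hk))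
  have hS10 : c ^ 10 ≤ (sitePercolation (Site 2) q).real (⋂ k ∈ Finset.range 10, uBoxA r k) := by
    calc c ^ 10 = ∏ _i ∈ Finset.range 10, c := by rw [Finset.prod_const, Finset.card_range]
      _ ≤ ∏ k ∈ Finset.range 10, (sitePercolation (Site 2) q).real (uBoxA r k) := Finset.prod_le_prod (fun _ _ => hc) hs
      _ ≤ _ := hS
  -- the comb
  have eG : c ^ 90 ≤ (sitePercolation (Site 2) q).real (⋂ i ∈ Finset.range 90, uCombA r i) := by
    have hprod := sitePercolation_real_biInter_ge_prod q (Finset.range 90) (E := fun i => uCombA r i)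
      (F := fun i => uCombAF r i) (fun i _ => determinedBy_triHCross _ _ _ _) (fun i _ => isUpperSet_triHCross _ _ _ _)
    have heach : ∀ i ∈ Finset.range 90, c ≤ (sitePercolation (Site 2) q).real (uCombA r i) := fun i _ => by
      rw [uCombA, show sitePercolation (Site 2) q = triSitePercolation q from rfl, triSitePercolation_real_triHCross]
      exact hcw _ _ (by omega) (by omega) (by omega)
    have hle : c ^ 90 ≤ ∏ i ∈ Finset.range 90, (sitePercolation (Site 2) q).real (uCombA r i) := by
      calc c ^ 90 = ∏ _i ∈ Finset.range 90, c := by rw [Finset.prod_const, Finset.card_range]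
        _ ≤ _ := Finset.prod_le_prod (fun _ _ => hc) heach
    exact hle.trans hprod
  have dF : DeterminedBy (uFenceA r) ↑(uFenceAF r) := determinedBy_uFenceA r
  have dS : DeterminedBy (⋂ k ∈ Finset.range 10, uBoxA r k) ↑((Finset.range 10).biUnion (uBoxAF r)) :=
    DeterminedBy.biInter_finset (Finset.range 10) (E := fun k => uBoxA r k) (F := fun k => uBoxAF r k)
      fun k hk => determinedBy_uBoxA r (Finset.mem_range.1 hk)
  have dG : DeterminedBy (⋂ i ∈ Finset.range 90, uCombA r i) ↑((Finset.range 90).biUnion (uCombAF r)) :=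
    DeterminedBy.biInter_finset (Finset.range 90) (E := fun i => uCombA r i) (F := fun i => uCombAF r i)
      fun i _ => determinedBy_triHCross _ _ _ _
  have uF : IsUpperSet (uFenceA r) :=
    isUpperSet_rot3_triVCross ((8 * (r / 64) : ℕ) - (8 * (r / 64) / 8 : ℕ) + 1) (-((8 * (r / 64) / 2 : ℕ) : ℤ) - (8 * (r / 64) / 64 : ℕ))
      (8 * (r / 64) / 8 - 2) (2 * (8 * (r / 64) / 64))
  have uS : IsUpperSet (⋂ k ∈ Finset.range 10, uBoxA r k) := isUpperSet_iInter₂ fun k hk => isUpperSet_uBoxA r (Finset.mem_range.1 hk)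
  have uG : IsUpperSet (⋂ i ∈ Finset.range 90, uCombA r i) := isUpperSet_iInter₂ fun i _ =>
    isUpperSet_triHCross ((r : ℤ) - (r / 8 : ℕ) - (r / 16 : ℕ) - 2) (-(sepGlueHeight r : ℤ) + i * ((r / 64 / 2 : ℕ) : ℤ)) (r / 8 + r / 16 + 1) (r / 64 / 2)
  have har1 := sitePercolation_harris' q dF dS uF uS
  have dFS : DeterminedBy (uFenceA r ∩ ⋂ k ∈ Finset.range 10, uBoxA r k) ↑(uFenceAF r ∪ (Finset.range 10).biUnion (uBoxAF r)) := by
    rw [Finset.coe_union]; exact (dF.mono Set.subset_union_left).inter (dS.mono Set.subset_union_right)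
  have har2 := sitePercolation_harris' q dFS dG (uF.inter uS) uG
  unfold triSitePercolation
  rw [uTurnA]
  have h0 : ∀ s, 0 ≤ (sitePercolation (Site 2) q).real s := fun s => measureReal_nonneg
  calc c ^ 101 = c * c ^ 10 * c ^ 90 := by ring
    _ ≤ (sitePercolation (Site 2) q).real (uFenceA r) * (sitePercolation (Site 2) q).real (⋂ k ∈ Finset.range 10, uBoxA r k) *
          (sitePercolation (Site 2) q).real (⋂ i ∈ Finset.range 90, uCombA r i) :=
        mul_le_mul (mul_le_mul hF hS10 (pow_nonneg hc _) (h0 _)) eG (pow_nonneg hc _) (mul_nonneg (h0 _) (h0 _))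
    _ ≤ (sitePercolation (Site 2) q).real (uFenceA r ∩ ⋂ k ∈ Finset.range 10, uBoxA r k) *
          (sitePercolation (Site 2) q).real (⋂ i ∈ Finset.range 90, uCombA r i) := mul_le_mul_of_nonneg_right har1 (h0 _)
    _ ≤ _ := har2

/-- **RSW and Harris for the closed U-turn at `q`**: `P_q(uTurnB r) ≥ c^101` (`4096 ≤ r ≤ Ncap`, aspect
ratio `ρ ≥ 64`). [cite: Nolin2008, §4.3 Prop. 12 (proof) (arXiv 0711.4948: Prop. 11)] -/
theorem le_real_uTurnB_at (q : unitInterval) {c : ℝ} {ρ Ncap : ℕ}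
    (hrsw : ∀ k : ℕ, 1 ≤ ⌊(ρ : ℝ) * k⌋₊ → k ≤ Ncap → c ≤ triLRCrossingProb q ⌊(ρ : ℝ) * k⌋₊ k)
    (hρ : 64 ≤ ρ) (hc : 0 ≤ c) {r : ℕ} (hr : 4096 ≤ r) (hcap : r ≤ Ncap) :
    c ^ 101 ≤ (triSitePercolation q).real (uTurnB r) := by
  classical
  have hfl : ∀ k : ℕ, ⌊(ρ : ℝ) * (k : ℕ)⌋₊ = ρ * k := fun k => by
    have : (ρ : ℝ) * (k : ℕ) = ((ρ * k : ℕ) : ℝ) := by push_cast; ring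
    rw [this, Nat.floor_natCast]
  have hcw : ∀ L k : ℕ, 1 ≤ k → k ≤ Ncap → L ≤ 64 * k → c ≤ triLRCrossingProb q L k := fun L k hk hkc hL => by
    have h := hrsw k (by rw [hfl]; nlinarith) hkc
    rw [hfl] at h
    exact h.trans (triLRCrossingProb_anti_width q (by nlinarith) k)
  obtain ⟨u1, u2, u3, u4, u5, u6, u7, u8, u9, u10, u11, u12, u13⟩ := masterUP hr
  have hF : c ≤ (sitePercolation (Site 2) q).real (uFenceB r) := by
    have h1 := real_preimage_frameConfig q 5
      (triVCross ((8 * (r / 64) : ℕ) - (8 * (r / 64) / 8 : ℕ) + 1) (-((8 * (r / 64) / 2 : ℕ) : ℤ) - (8 * (r / 64) / 64 : ℕ))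
        (8 * (r / 64) / 8 - 2) (2 * (8 * (r / 64) / 64)))
    rw [triSitePercolation_real_triVCross] at h1
    unfold triSitePercolation at h1
    rw [uFenceB, show {κ : SiteConfig (Site 2) | frameConfig 5 κ ∈ triVCross ((8 * (r / 64) : ℕ) - (8 * (r / 64) / 8 : ℕ) + 1)
        (-((8 * (r / 64) / 2 : ℕ) : ℤ) - (8 * (r / 64) / 64 : ℕ)) (8 * (r / 64) / 8 - 2) (2 * (8 * (r / 64) / 64))} =
      frameConfig 5 ⁻¹' triVCross ((8 * (r / 64) : ℕ) - (8 * (r / 64) / 8 : ℕ) + 1) (-((8 * (r / 64) / 2 : ℕ) : ℤ) - (8 * (r / 64) / 64 : ℕ))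
        (8 * (r / 64) / 8 - 2) (2 * (8 * (r / 64) / 64)) from rfl, h1]
    exact hcw _ _ (by omega) (by omega) (by omega)
  have hs : ∀ k ∈ Finset.range 10, c ≤ (sitePercolation (Site 2) q).real (uBoxB r k) := by
    intro k hk
    have hk' := Finset.mem_range.1 hk
    interval_cases k
    · rw [uBoxB, show sitePercolation (Site 2) q = triSitePercolation q from rfl, triSitePercolation_real_triHCross]
      exact hcw _ _ (by omega) (by omega) (by omega)
    · rw [uBoxB, show sitePercolation (Site 2) q = triSitePercolation q from rfl, triSitePercolation_real_triVCross]
      exact hcw _ _ (by omega) (by omega) (by omega)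
    · rw [uBoxB, show sitePercolation (Site 2) q = triSitePercolation q from rfl, triSitePercolation_real_triHCross]
      exact hcw _ _ (by omega) (by omega) (by omega)
    · rw [uBoxB, show sitePercolation (Site 2) q = triSitePercolation q from rfl, triSitePercolation_real_triVCross]
      exact hcw _ _ (by omega) (by omega) (by omega)
    · rw [uBoxB, show sitePercolation (Site 2) q = triSitePercolation q from rfl, triSitePercolation_real_triHCross]
      exact hcw _ _ (by omega) (by omega) (by omega)
    · rw [uBoxB, show sitePercolation (Site 2) q = triSitePercolation q from rfl, triSitePercolation_real_triVCross]
      exact hcw _ _ (by omega) (by omega) (by omega)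
    · rw [uBoxB, show sitePercolation (Site 2) q = triSitePercolation q from rfl, triSitePercolation_real_triHCross]
      exact hcw _ _ (by omega) (by omega) (by omega)
    · rw [uBoxB, show sitePercolation (Site 2) q = triSitePercolation q from rfl, triSitePercolation_real_triVCross]
      exact hcw _ _ (by omega) (by omega) (by omega)
    · rw [uBoxB, show sitePercolation (Site 2) q = triSitePercolation q from rfl, triSitePercolation_real_triHCross]
      exact hcw _ _ (by omega) (by omega) (by omega)
    · rw [uBoxB, show sitePercolation (Site 2) q = triSitePercolation q from rfl, triSitePercolation_real_triVCross]
      exact hcw _ _ (by omega) (by omega) (by omega)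
  have hS := sitePercolation_real_biInter_ge_prod q (Finset.range 10) (E := fun k => uBoxB r k)
    (F := fun k => uBoxBF r k) (fun k hk => determinedBy_uBoxB r (Finset.mem_range.1 hk))
    (fun k hk => isUpperSet_uBoxB r (Finset.mem_range.1 hk))
  have hS10 : c ^ 10 ≤ (sitePercolation (Site 2) q).real (⋂ k ∈ Finset.range 10, uBoxB r k) := by
    calc c ^ 10 = ∏ _i ∈ Finset.range 10, c := by rw [Finset.prod_const, Finset.card_range]
      _ ≤ ∏ k ∈ Finset.range 10, (sitePercolation (Site 2) q).real (uBoxB r k) := Finset.prod_le_prod (fun _ _ => hc) hs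
      _ ≤ _ := hS
  have eG : c ^ 90 ≤ (sitePercolation (Site 2) q).real (⋂ i ∈ Finset.range 90, inCombB r i) := by
    have hprod := sitePercolation_real_biInter_ge_prod q (Finset.range 90) (E := fun i => inCombB r i)
      (F := fun i => inCombBF r i) (fun i _ => determinedBy_triVCross _ _ _ _) (fun i _ => isUpperSet_triVCross _ _ _ _)
    have heach : ∀ i ∈ Finset.range 90, c ≤ (sitePercolation (Site 2) q).real (inCombB r i) := fun i _ => by
      rw [inCombB, show sitePercolation (Site 2) q = triSitePercolation q from rfl, triSitePercolation_real_triVCross]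
      exact hcw _ _ (by omega) (by omega) (by omega)
    have hle : c ^ 90 ≤ ∏ i ∈ Finset.range 90, (sitePercolation (Site 2) q).real (inCombB r i) := by
      calc c ^ 90 = ∏ _i ∈ Finset.range 90, c := by rw [Finset.prod_const, Finset.card_range]
        _ ≤ _ := Finset.prod_le_prod (fun _ _ => hc) heach
    exact hle.trans hprod
  have dF : DeterminedBy (uFenceB r) ↑(uFenceBF r) := determinedBy_uFenceB r
  have dS : DeterminedBy (⋂ k ∈ Finset.range 10, uBoxB r k) ↑((Finset.range 10).biUnion (uBoxBF r)) :=
    DeterminedBy.biInter_finset (Finset.range 10) (E := fun k => uBoxB r k) (F := fun k => uBoxBF r k)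
      fun k hk => determinedBy_uBoxB r (Finset.mem_range.1 hk)
  have dG : DeterminedBy (⋂ i ∈ Finset.range 90, inCombB r i) ↑((Finset.range 90).biUnion (inCombBF r)) :=
    DeterminedBy.biInter_finset (Finset.range 90) (E := fun i => inCombB r i) (F := fun i => inCombBF r i)
      fun i _ => determinedBy_triVCross _ _ _ _
  have uF : IsUpperSet (uFenceB r) := isUpperSet_preimage_frameConfig 5
    (isUpperSet_triVCross ((8 * (r / 64) : ℕ) - (8 * (r / 64) / 8 : ℕ) + 1) (-((8 * (r / 64) / 2 : ℕ) : ℤ) - (8 * (r / 64) / 64 : ℕ))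
      (8 * (r / 64) / 8 - 2) (2 * (8 * (r / 64) / 64)))
  have uS : IsUpperSet (⋂ k ∈ Finset.range 10, uBoxB r k) := isUpperSet_iInter₂ fun k hk => isUpperSet_uBoxB r (Finset.mem_range.1 hk)
  have uG : IsUpperSet (⋂ i ∈ Finset.range 90, inCombB r i) := isUpperSet_iInter₂ fun i _ =>
    isUpperSet_triVCross (-(sepGlueHeight r : ℤ) + i * ((r / 64 / 2 : ℕ) : ℤ)) ((r : ℤ) - (r / 8 : ℕ) - (r / 16 : ℕ) - 2) (r / 64 / 2) (r / 8 + r / 16 + 1)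
  have har1 := sitePercolation_harris' q dF dS uF uS
  have dFS : DeterminedBy (uFenceB r ∩ ⋂ k ∈ Finset.range 10, uBoxB r k) ↑(uFenceBF r ∪ (Finset.range 10).biUnion (uBoxBF r)) := by
    rw [Finset.coe_union]; exact (dF.mono Set.subset_union_left).inter (dS.mono Set.subset_union_right)
  have har2 := sitePercolation_harris' q dFS dG (uF.inter uS) uG
  unfold triSitePercolation
  rw [uTurnB]
  have h0 : ∀ s, 0 ≤ (sitePercolation (Site 2) q).real s := fun s => measureReal_nonneg
  calc c ^ 101 = c * c ^ 10 * c ^ 90 := by ring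
    _ ≤ (sitePercolation (Site 2) q).real (uFenceB r) * (sitePercolation (Site 2) q).real (⋂ k ∈ Finset.range 10, uBoxB r k) *
          (sitePercolation (Site 2) q).real (⋂ i ∈ Finset.range 90, inCombB r i) :=
        mul_le_mul (mul_le_mul hF hS10 (pow_nonneg hc _) (h0 _)) eG (pow_nonneg hc _) (mul_nonneg (h0 _) (h0 _))
    _ ≤ (sitePercolation (Site 2) q).real (uFenceB r ∩ ⋂ k ∈ Finset.range 10, uBoxB r k) *
          (sitePercolation (Site 2) q).real (⋂ i ∈ Finset.range 90, inCombB r i) := mul_le_mul_of_nonneg_right har1 (h0 _)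
    _ ≤ _ := har2

end Literature.Probability.Percolation
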